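import Literature.Geometry.Lorentzian.KerrIngoingCoordRiemann
import Literature.Geometry.Lorentzian.KerrIngoingCoordRiemannII
import Literature.Geometry.Lorentzian.KerrIngoingCoordRiemannIII
import Literature.Geometry.Lorentzian.KerrRicciFlat
import Literature.Geometry.Lorentzian.CoordRicciCovariance
import Literature.Geometry.Lorentzian.KerrSchildChartCovariance
import Literature.Geometry.Lorentzian.CoordCurvatureNormSq

/-!
# Fact F3 of the line `crush-the-swallowed-interior`: the Kretschmann scalar of the Kerr metric

Support for the crux `PhotonSphereChannels.TameCensorship` (item
stmt-FinalStateConjecture-10047), stub `stub_factKerrKretschmann` of the lead's skeleton: for ALL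
real `M, a` and every point `x` of the ingoing Kerr–Schild Cartesian chart with Kerr–Schild radius
`r = Kerr.radius a x > 0`,

  `|Rm|²(g_{M,a})(x) = 48 M² Re (r + i a cos θ)⁶ / (r² + a² cos²θ)⁶`,  `cos θ = x₃ / r`,

where `|Rm|² = MetricCoord.rmNormSqAt (Kerr.bilin M a) x` is Topping's square norm of the
curvature tensor of the component field (`CoordCurvatureNormSq.lean`; `= R_{abcd}R^{abcd}`, the
Kretschmann scalar) — Henry, Astrophys. J. 535 (2000) 350 (case `Q = 0`); Cherubini–Bini–
Capozziello–Ruffini, Int. J. Mod. Phys. D 11 (2002) 827, §4.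

## Proof

Off the rotation axis `{x₁ = x₂ = 0}` the chart domain `Kerr.region a 0 = {r > 0}` is covered by
the ingoing Kerr coordinates `u = (t*, r, μ, φ)` (`Kerr.Ingoing.chartFun`, a change of
coordinates onto its image, `isCoordChangeOn_chartFun`), along which the Kerr–Schild components
pull back to the rational components `Kerr.Ingoing.bilin M a` (`Kerr.Ingoing.kerrBilin_jac`);
`|Rm|²` is natural under changes of coordinates (`MetricCoord.rmNormSqAt_pullMetric`) and local in
the components, and for the rational components it is the closed form
`rmNormSqAt_ingoing` below (from the curvature matrices of `KerrIngoingCoordRiemann{,II,III}.lean`;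
with `r(Ψ u) = u 1`, `x₃(Ψ u)/r = μ`). On the axis both sides are continuous on the open chart
domain,
so the identity extends by density (`Kerr.eqOn_region_of_offAxis`).
-/

noncomputable section

set_option maxSynthPendingDepth 3

namespace
  Summit.FinalStateConjecture.FinalStateConjecture.Theorems.PhotonSphereChannels.TameCensorshipCrush

open Literature.Geometry.Lorentzian Literature.Geometry.Lorentzian.Kerr.Ingoing
open Literature.Geometry.Lorentzian.MetricCoord
open scoped Manifold ContDiff Topology
open Set Filter

/-! ### The Kretschmann scalar of the rational Kerr components in ingoing Kerr coordinates -/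

section Ingoing

variable (M a : ℝ) {u : E4}

/-- `|Rm|²` of the rational Kerr components `Kerr.Ingoing.bilin M a` through the coordinate basis:
`|Rm|² = −Σ_{AA'} g^{AA'} Σ_{cc'} g^{cc'} tr(R(∂_A,∂_c) ∘ R(∂_{A'},∂_{c'}))`
(`MetricCoord.rmNormSqAt_eq_sum` with `g⁻¹ = Kerr.Ingoing.ginvMat`, `Kerr.Ingoing.ginv_basisFun`).
-/
theorem rmNormSqAt_eq_sum_ginvMat (hu : u ∈ regularSet a) :
    MetricCoord.rmNormSqAt (bilin M a) u = -∑ A, ∑ A', ginvMat M a u A A' *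
      ∑ c, ∑ c', ginvMat M a u c c' * traceCLM E4 ((riemAt (bilin M a) u (E4.basisVector A)
        (E4.basisVector c)).comp (riemAt (bilin M a) u (E4.basisVector A') (E4.basisVector c'))) :=
        by
  rw [rmNormSqAt_eq_sum (EuclideanSpace.basisFun (Fin 4) ℝ).toBasis]
  simp only [ginv_basisFun M a hu, basisFun_toBasis_apply]
  congr 1
  refine Finset.sum_congr rfl fun A _ ↦ Finset.sum_congr rfl fun A' _ ↦ ?_
  rw [Finset.mul_sum]
  refine Finset.sum_congr rfl fun c _ ↦ ?_
  rw [Finset.mul_sum]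
  refine Finset.sum_congr rfl fun c' _ ↦ ?_
  ring

-- The next proof expands `|Rm|²` into the 28 traces `tr(R(∂_A,∂_C) ∘ R(∂_{A'},∂_{C'}))` with
-- `g^{AA'}g^{CC'} ≠ 0`, inserts the curvature matrices of `KerrIngoingCoordRiemann{,II,III}.lean`
-- and clears the denominators: one large rational identity (about two minutes of `ring`).
set_option maxHeartbeats 0 in
/-- **The Kretschmann scalar of the Kerr metric in ingoing Kerr coordinates**: for the rational
component field `Kerr.Ingoing.bilin M a` at every point of the regular set `{Σ ≠ 0, μ² ≠ 1}`,
`|Rm|² = 48 M² (r⁶ − 15 a² r⁴ μ² + 15 a⁴ r² μ⁴ − a⁶ μ⁶)/Σ⁶ = 48 M² Re (r + i a μ)⁶/Σ⁶`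
(`Σ = r² + a²μ²`; Henry, Astrophys. J. 535 (2000) 350, eq. for `Q = 0`; Cherubini–Bini–
Capozziello–Ruffini, Int. J. Mod. Phys. D 11 (2002) 827, §4), for all real `M, a`. Proof:
`rmNormSqAt_eq_sum_ginvMat`, the curvature matrices `Kerr.Ingoing.riem_AC`
(`Kerr.Ingoing.trace_comp_of_matrix`) and `field_simp`/`ring`. -/
theorem rmNormSqAt_ingoing (hu : u ∈ regularSet a) :
    MetricCoord.rmNormSqAt (bilin M a) u = (-(48 * u 2 ^ (6 : ℕ) * M ^ (2 : ℕ) * a ^ (6 : ℕ)) +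
      720 * u 1 ^ (2 : ℕ) * u 2 ^ (4 : ℕ) * M ^ (2 : ℕ) * a ^ (4 : ℕ) -
      720 * u 1 ^ (4 : ℕ) * u 2 ^ (2 : ℕ) * M ^ (2 : ℕ) * a ^ (2 : ℕ) +
      48 * u 1 ^ (6 : ℕ) * M ^ (2 : ℕ)) / sigma a u ^ (6 : ℕ) := by
  have hS := hu.1
  have hP := hu.2
  rw [rmNormSqAt_eq_sum_ginvMat M a hu]
  simp only [Fin.sum_univ_four, ginvMat, Matrix.of_apply, Matrix.cons_val', Matrix.cons_val_zero,
    Matrix.cons_val_one, Matrix.cons_val, Matrix.empty_val', Matrix.cons_val_fin_one, riemAt_self,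
    ContinuousLinearMap.zero_comp, ContinuousLinearMap.comp_zero, map_zero,
    riemAt_swap (bilin M a) u (E4.basisVector 0) (E4.basisVector 1),
    riemAt_swap (bilin M a) u (E4.basisVector 0) (E4.basisVector 3),
    riemAt_swap (bilin M a) u (E4.basisVector 1) (E4.basisVector 3),
    riemAt_swap (bilin M a) u (E4.basisVector 2) (E4.basisVector 3),
    riemAt_swap (bilin M a) u (E4.basisVector 0) (E4.basisVector 2),
    riemAt_swap (bilin M a) u (E4.basisVector 1) (E4.basisVector 2), ContinuousLinearMap.neg_comp,
    ContinuousLinearMap.comp_neg, map_neg,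
    Kerr.Ingoing.traceCLM_comp_comm (riemAt (bilin M a) u (E4.basisVector 0) (E4.basisVector 3))
    (riemAt (bilin M a) u (E4.basisVector 0) (E4.basisVector 1)),
    Kerr.Ingoing.traceCLM_comp_comm (riemAt (bilin M a) u (E4.basisVector 1) (E4.basisVector 2))
    (riemAt (bilin M a) u (E4.basisVector 0) (E4.basisVector 2)),
    Kerr.Ingoing.traceCLM_comp_comm (riemAt (bilin M a) u (E4.basisVector 1) (E4.basisVector 3))
    (riemAt (bilin M a) u (E4.basisVector 0) (E4.basisVector 1)),
    Kerr.Ingoing.traceCLM_comp_comm (riemAt (bilin M a) u (E4.basisVector 1) (E4.basisVector 3))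
    (riemAt (bilin M a) u (E4.basisVector 0) (E4.basisVector 3)),
    Kerr.Ingoing.traceCLM_comp_comm (riemAt (bilin M a) u (E4.basisVector 2) (E4.basisVector 3))
    (riemAt (bilin M a) u (E4.basisVector 1) (E4.basisVector 2)), mul_neg, neg_mul, neg_neg,
    mul_zero, zero_mul, add_zero, zero_add, neg_zero]
  rw [trace_comp_of_matrix _ _ _ _ (riem_01 M a hu) (riem_01 M a hu),
    trace_comp_of_matrix _ _ _ _ (riem_01 M a hu) (riem_03 M a hu),
    trace_comp_of_matrix _ _ _ _ (riem_02 M a hu) (riem_02 M a hu),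
    trace_comp_of_matrix _ _ _ _ (riem_03 M a hu) (riem_03 M a hu),
    trace_comp_of_matrix _ _ _ _ (riem_01 M a hu) (riem_13 M a hu),
    trace_comp_of_matrix _ _ _ _ (riem_02 M a hu) (riem_12 M a hu),
    trace_comp_of_matrix _ _ _ _ (riem_03 M a hu) (riem_13 M a hu),
    trace_comp_of_matrix _ _ _ _ (riem_12 M a hu) (riem_12 M a hu),
    trace_comp_of_matrix _ _ _ _ (riem_13 M a hu) (riem_13 M a hu),
    trace_comp_of_matrix _ _ _ _ (riem_12 M a hu) (riem_23 M a hu),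
    trace_comp_of_matrix _ _ _ _ (riem_23 M a hu) (riem_23 M a hu)]
  simp only [Fin.sum_univ_four, Matrix.of_apply, Matrix.cons_val', Matrix.cons_val_zero,
    Matrix.cons_val_one, Matrix.cons_val, Matrix.empty_val', Matrix.cons_val_fin_one, h00, scalarH,
    mul_zero, zero_mul, add_zero, zero_add]
  field_simp
  simp only [sigma, sinSq]
  ring

end Ingoing

/-! ### Transfer to the Kerr–Schild chart -/

/-- The ingoing Kerr chart `Ψ = Kerr.Ingoing.chartFun a r₀` is a change of coordinates from the
coordinate domain onto the Kerr–Schild chart domain `Kerr.region a r₀` (smooth, into, with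
invertible Jacobian). -/
theorem isCoordChangeOn_chartFun (a r₀ : ℝ) :
    MetricCoord.IsCoordChangeOn (Kerr.Ingoing.chartFun a r₀)
      (Kerr.Ingoing.coordDomain r₀ : Set E4) (Kerr.region a r₀ : Set E4) where
  isOpen := (Kerr.Ingoing.coordDomain r₀).isOpen
  contDiffOn := fun _ hu ↦ (Kerr.Ingoing.contDiffAt_chartFun hu).contDiffWithinAt
  mapsTo := fun u _ ↦ Kerr.Ingoing.chartFun_mem_region a r₀ u
  isInvertible := fun u hu ↦ by
    rw [Kerr.Ingoing.fderiv_chartFun hu]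
    exact KerrSchildChart.isInvertible_of_injective (Kerr.Ingoing.jac_injective hu)

/-- Along the ingoing Kerr chart the Kerr–Schild components pull back to the rational components
`Kerr.Ingoing.bilin M a` (`Kerr.Ingoing.kerrBilin_jac`). -/
theorem pullMetric_chartFun_eq (M a r₀ : ℝ) {u : E4} (hu : u ∈ Kerr.Ingoing.coordDomain r₀) :
    MetricCoord.pullMetric (Kerr.bilin M a) (Kerr.Ingoing.chartFun a r₀) u =
      Kerr.Ingoing.bilin M a u := by
  ext v w
  rw [MetricCoord.pullMetric_apply, Kerr.Ingoing.fderiv_chartFun hu,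
    Kerr.Ingoing.kerrBilin_jac hu]

/-- `|Rm|²` at a point only depends on the components on an open neighbourhood of the point. -/
theorem rmNormSqAt_congr_of_eqOn {G G' : E4 → E4 →L[ℝ] E4 →L[ℝ] ℝ} {U : Set E4} {x : E4}
    (hU : IsOpen U) (h : ∀ y ∈ U, G y = G' y) (hx : x ∈ U) :
    MetricCoord.rmNormSqAt G x = MetricCoord.rmNormSqAt G' x := by
  rw [MetricCoord.rmNormSqAt_eq_sum (Module.finBasis ℝ E4),
    MetricCoord.rmNormSqAt_eq_sum (Module.finBasis ℝ E4),
    MetricCoord.riemAt_congr_of_eqOn hU h hx]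
  simp only [MetricCoord.ginv, MetricCoord.sharpAt, h x hx]

/-- `Re (p + i q)⁶ = p⁶ − 15 p⁴ q² + 15 p² q⁴ − q⁶`. -/
theorem re_add_mul_I_pow_six (p q : ℝ) :
    (((p : ℂ) + (q : ℂ) * Complex.I) ^ 6).re =
      p ^ 6 - 15 * p ^ 4 * q ^ 2 + 15 * p ^ 2 * q ^ 4 - q ^ 6 := by
  simp [pow_succ, Complex.mul_re, Complex.mul_im]
  ring

/-- The right-hand side `48 M² Re (r + i a x₃/r)⁶ / (r² + a² x₃²/r²)⁶` is continuous on the chart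
domain `{r > 0}`. -/
theorem continuousOn_rhs (M a : ℝ) :
    ContinuousOn (fun y : E4 ↦ 48 * M ^ 2 * (((Kerr.radius a y : ℂ) +
        ((a * (y 3 / Kerr.radius a y) : ℝ) : ℂ) * Complex.I) ^ 6).re /
        (Kerr.radius a y ^ 2 + (a * (y 3 / Kerr.radius a y)) ^ 2) ^ 6)
      (Kerr.region a 0 : Set E4) := by
  have hr : Continuous (Kerr.radius a) := Kerr.continuous_radius a
  have h3 : Continuous fun y : E4 ↦ y 3 := (EuclideanSpace.proj (3 : Fin 4)).continuous
  have hr0 : ∀ y ∈ (Kerr.region a 0 : Set E4), Kerr.radius a y ≠ 0 :=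
    fun y hy ↦ (Kerr.radius_pos_of_mem_region hy).ne'
  have hμ : ContinuousOn (fun y : E4 ↦ a * (y 3 / Kerr.radius a y)) (Kerr.region a 0 : Set E4) :=
    continuousOn_const.mul (h3.continuousOn.div hr.continuousOn hr0)
  have hz : ContinuousOn (fun y : E4 ↦ (Kerr.radius a y : ℂ) +
      ((a * (y 3 / Kerr.radius a y) : ℝ) : ℂ) * Complex.I) (Kerr.region a 0 : Set E4) :=
    (Complex.continuous_ofReal.comp_continuousOn hr.continuousOn).add
      ((Complex.continuous_ofReal.comp_continuousOn hμ).mul continuousOn_const)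
  have hre := Complex.continuous_re.comp_continuousOn (hz.pow 6)
  have hden : ContinuousOn
      (fun y : E4 ↦ (Kerr.radius a y ^ 2 + (a * (y 3 / Kerr.radius a y)) ^ 2) ^ 6)
      (Kerr.region a 0 : Set E4) := ((hr.continuousOn.pow 2).add (hμ.pow 2)).pow 6
  have hden0 : ∀ y ∈ (Kerr.region a 0 : Set E4),
      (Kerr.radius a y ^ 2 + (a * (y 3 / Kerr.radius a y)) ^ 2) ^ 6 ≠ 0 := fun y hy ↦ by
    have := Kerr.radius_pos_of_mem_region hy
    positivity
  exact (continuousOn_const.mul hre).div hden hden0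

/-- **FACT F3 — the Kretschmann scalar of the Kerr metric** (in the tree's conventions: Topping's
`|Rm|² = −Σ g^{aa'}g^{cc'} tr(R(b_a,b_c) R(b_{a'},b_{c'}))` of the Kerr–Schild component field
`Kerr.bilin M a`, `= R_{abcd}R^{abcd}`): on `{r > 0}`,
`|Rm|² = 48 M² Re (r + i a cos θ)⁶ / Σ⁶`, `cos θ = x₃/r`, `Σ = r² + a² cos² θ`, for all real
`M, a` (Henry, Astrophys. J. 535 (2000) 350, eq. for `Q = 0`; Cherubini–Bini–Capozziello–Ruffini,
Int. J. Mod. Phys. D 11 (2002) 827, §4). Proof: ingoing Kerr coordinates off the axis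
(`rmNormSqAt_ingoing`, naturality `MetricCoord.rmNormSqAt_pullMetric`) and density
(`Kerr.eqOn_region_of_offAxis`). -/
theorem stub_factKerrKretschmann :
    ∀ (M a : ℝ) (x : E4), 0 < Kerr.radius a x →
      MetricCoord.rmNormSqAt (Kerr.bilin M a) x =
        48 * M ^ 2 * (((Kerr.radius a x : ℂ) +
          ((a * (x 3 / Kerr.radius a x) : ℝ) : ℂ) * Complex.I) ^ 6).re /
          (Kerr.radius a x ^ 2 + (a * (x 3 / Kerr.radius a x)) ^ 2) ^ 6 := by
  intro M a x hx
  have hxr : x ∈ Kerr.region a 0 := by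
    rw [Kerr.mem_region, max_self]; exact hx
  -- the difference of the two sides, as a function on the chart domain `{r > 0}`
  set F : E4 → ℝ := fun y ↦ MetricCoord.rmNormSqAt (Kerr.bilin M a) y -
    48 * M ^ 2 * (((Kerr.radius a y : ℂ) +
      ((a * (y 3 / Kerr.radius a y) : ℝ) : ℂ) * Complex.I) ^ 6).re /
      (Kerr.radius a y ^ 2 + (a * (y 3 / Kerr.radius a y)) ^ 2) ^ 6 with hF
  suffices h : ∀ y ∈ Kerr.region a 0, F y = 0 by
    have h0 := h x hxr
    rw [hF] at h0
    exact sub_eq_zero.mp h0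
  refine Kerr.eqOn_region_of_offAxis ?_ ?_
  · -- both sides are continuous on the open chart domain
    rw [hF]
    exact (KerrSchildChart.isMetricOn_kerrBilin M a 0).contDiffOn_rmNormSqAt.continuousOn.sub
      (continuousOn_rhs M a)
  · -- off the axis: ingoing Kerr coordinates
    intro y hy hax
    obtain ⟨u, hu, rfl⟩ := Kerr.Ingoing.exists_chartFun_eq (a := a) hy hax
    have hreg : u ∈ Kerr.Ingoing.regularSet a :=
      Kerr.Ingoing.mem_regularSet_of_mem_coordDomain hu
    have hu1 : 0 < u 1 := Kerr.Ingoing.radial_pos hu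
    have hrad : Kerr.radius a (Kerr.Ingoing.chartFun a 0 u) = u 1 := by
      rw [Kerr.Ingoing.radius_chartFun, Kerr.Ingoing.radialParam_of_lt hu.1]
    have h3 : Kerr.Ingoing.chartFun a 0 u 3 = u 1 * u 2 := by
      rw [Kerr.Ingoing.chartFun_eq hu, show (3 : Fin 4) = Fin.succ 2 from rfl,
        E4.ofTimeSpace_apply_succ, Kerr.kerrStar_apply_two, Kerr.Ingoing.cos_arccos_eq hu]
    -- naturality of `|Rm|²` along the chart, and locality
    have hnat : MetricCoord.rmNormSqAt (Kerr.bilin M a) (Kerr.Ingoing.chartFun a 0 u) =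
        MetricCoord.rmNormSqAt (Kerr.Ingoing.bilin M a) u := by
      rw [← MetricCoord.rmNormSqAt_pullMetric (KerrSchildChart.isMetricOn_kerrBilin M a 0)
        (isCoordChangeOn_chartFun a 0) hu]
      exact rmNormSqAt_congr_of_eqOn (Kerr.Ingoing.coordDomain (0 : ℝ)).isOpen
        (fun y hy ↦ pullMetric_chartFun_eq M a 0 hy) hu
    rw [hF]
    show MetricCoord.rmNormSqAt (Kerr.bilin M a) (Kerr.Ingoing.chartFun a 0 u) - _ = 0
    rw [hnat, rmNormSqAt_ingoing M a hreg, hrad, h3, re_add_mul_I_pow_six, sub_eq_zero]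
    have hS : Kerr.Ingoing.sigma a u ≠ 0 := hreg.1
    simp only [Kerr.Ingoing.sigma] at hS ⊢
    field_simp
    ring

end
  Summit.FinalStateConjecture.FinalStateConjecture.Theorems.PhotonSphereChannels.TameCensorshipCrush

end
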